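import Mathlib

/-!
# `Balaban1983to89.B6Eq232GaussianMoment` — T. Bałaban, *Propagators and renormalization transformations for lattice
# gauge theories. II*, Commun. Math. Phys. **96** (1984) 223–250 [Balaban1984PropagatorsII], Sect. A (2.32) p. 227:
# `R∂*GQ* = Z⁻¹∫dA e^{−½⟨A,Δ_aA⟩} R∂*A QA` — the Gaussian second moment, PROVED (with the Gaussian first moment with a
# source and its `t`-derivative under the integral sign)

statement-level skeleton of published theorems with citation tags; proofs where landed; nothing here is a claim about the Yang–Mills mass gap

PDF held: `paper:balaban1984-cmp96-propagators-rt-ii` (journal page = PDF page + 222); p. 227 read AS IMAGE on the ×2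
render `run/shared/lean/pub/pub-balaban/b2b-balaban-ref1/pages/1984-cmp96-propagators-rt-II/…-p005-x2.png` (2026-08-21).

CITATION HEADER (lean-in-tree rule).  WHAT IS REPRODUCED: the display (2.32) of lit-balaban SKELETON row **B6.Eq2.34**
((2.32)–(2.34) pp. 227–228; head `R∂*GQ* = 0`, `QG∂R = 0` = the algebraic theorems of record `…B6Eq231.eq234_left` /
`eq234_right`, p239491; census C-B6-2 *"Gaussian derivation absent"*).  File 3/4 of the PRINTED Gaussian route by
PHASE-2 seat p22 (gen 4): `…B6Eq228FaddeevPopov` ((2.28)–(2.30) pointwise), `…B6Eq230GaussianRoute` ((2.29)/(2.30) ⇒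
(2.31)), this file ((2.32)), `…B6Eq233GaussianRoute` ((2.33) ⇒ (2.34)).  Owner r03, referee ref-4.  Imports Mathlib only;
nothing of the tree is restated (the moment-generating function itself is `…B6Eq295.integral_exp_quadratic_add_linear`;
here the first and second MOMENTS are derived, which the tree did not have).

PRINT (p. 227 [PDF 5], verbatim).  *"Now we consider the operator R∂*GQ*. We have
  R∂*GQ* = Z⁻¹∫dA e^{−½⟨A,Δ_aA⟩} R∂*A QA.   (2.32)
Applying the same operations as in (2.28)–(2.30) we get, …"* ((2.33), next file).  Context: `Z = ∫dA e^{−½⟨A,Δ_aA⟩}`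
((2.28)), `G = Δ_a⁻¹` ((2.22)), `R` the orthogonal projection onto `ΔN(Q′)` (p. 225), `Q*` the adjoint of `Q`, `∂*` of `∂`.

TYPING.  (2.32) is an identity between an operator `W → V` and an operator-valued Gaussian integral (`R∂*A ⊗ QA`); it is
typed through MATRIX ELEMENTS: `Z·⟨g, R∂*GQ*u⟩ = ∫dA e^{−½⟨A,Δ_aA⟩}⟨g,R∂*A⟩⟨QA,u⟩` for all `g ∈ V`, `u ∈ W` — the
Gaussian covariance identity `∫ e^{−½⟨A,MA⟩}⟨A,J₁⟩⟨A,J₂⟩dA = Z⟨J₁,M⁻¹J₂⟩` with `J₁ = ∂Rg`, `J₂ = Q*u`.  `dA` is any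
measure on the real inner-product space `A` invariant under translations and under `A → −A` (Lebesgue measure on the
finite-dimensional configuration space is one), `M = Δ_a` symmetric with `MG = I`, and the Gaussian `e^{−½⟨A,MA⟩}`
integrable (⇐ `Z ≠ 0`; from positivity of `Δ_a`: `…B6Eq230GaussianRoute.Z_pos`).

CONTENTS (all theorems; no definitions).
§1 `gauss_complete_square`, `gauss_shift_eq`, `integrable_gauss_shift`, `integrable_gauss_linear` (shifted Gaussians and
   Gaussian × linear form are integrable when the Gaussian is), **`integral_gauss_linear`** (first moment with a source:
   `∫e^{−½⟨A,MA⟩+⟨A,J⟩}⟨A,J₁⟩ = ⟨GJ,J₁⟩e^{½⟨J,GJ⟩}Z`, by the translation `A → A + GJ` and oddness), **`integral_gauss_bilinear`**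
   (second moment `∫e^{−½⟨A,MA⟩}⟨A,J₁⟩⟨A,J₂⟩ = ⟨GJ₂,J₁⟩Z`: the `t`-derivative at `0` of the first moment with source `tJ₂`,
   differentiated under the integral sign — `hasDerivAt_integral_of_dominated_loc_of_deriv_le`, dominated by four shifted
   Gaussians).
§2 **`eq232`** — (2.32) in matrix elements.
Unit `lit-balaban-p22` (gen 4), HOME `run/shared/lean/pub/lit-balaban/`.
-/

noncomputable section

open MeasureTheory
open scoped InnerProductSpace

namespace Literature.MathematicalPhysics.QuantumFieldTheory.Balaban1983to89.B6Eq232GaussianMoment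

/-! ## §1  Gaussian first and second moments on an abstract real inner-product space -/

section GaussianMoments

variable {A : Type*} [NormedAddCommGroup A] [InnerProductSpace ℝ A]

/-- Completing the square (the translation `A → A + GJ` behind every Gaussian evaluation of Sect. A):
`−½⟨v+GJ, M(v+GJ)⟩ + ⟨v+GJ, J⟩ = ½⟨J,GJ⟩ − ½⟨v,Mv⟩` for `M` symmetric, `MG = I`. [cite: Balaban1984PropagatorsII, (2.28) p.227] -/
theorem gauss_complete_square (M G : A →ₗ[ℝ] A) (hM : ∀ x y : A, ⟪M x, y⟫_ℝ = ⟪x, M y⟫_ℝ)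
    (hMG : M ∘ₗ G = LinearMap.id) (J v : A) :
    -(1 / 2) * ⟪G J + v, M (G J + v)⟫_ℝ + ⟪G J + v, J⟫_ℝ =
      (1 / 2) * ⟪J, G J⟫_ℝ + -(1 / 2) * ⟪v, M v⟫_ℝ := by
  have hGJ : M (G J) = J := by simpa using LinearMap.congr_fun hMG J
  have hcross : ⟪G J, M v⟫_ℝ = ⟪v, J⟫_ℝ := by rw [← hM, hGJ, real_inner_comm]
  rw [map_add, hGJ, inner_add_left, inner_add_right, inner_add_right, hcross, inner_add_left,
    real_inner_comm J (G J)]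
  ring

/-- A Gaussian with a source is a translate of the Gaussian: `e^{−½⟨v,Mv⟩ + ⟨v,J⟩} = e^{½⟨J,GJ⟩} e^{−½⟨v−GJ, M(v−GJ)⟩}`.
[cite: Balaban1984PropagatorsII, (2.28) p.227] -/
theorem gauss_shift_eq (M G : A →ₗ[ℝ] A) (hM : ∀ x y : A, ⟪M x, y⟫_ℝ = ⟪x, M y⟫_ℝ)
    (hMG : M ∘ₗ G = LinearMap.id) (J v : A) :
    Real.exp (-(1 / 2) * ⟪v, M v⟫_ℝ + ⟪v, J⟫_ℝ) =
      Real.exp ((1 / 2) * ⟪J, G J⟫_ℝ) * Real.exp (-(1 / 2) * ⟪v - G J, M (v - G J)⟫_ℝ) := by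
  rw [← Real.exp_add]
  have h := gauss_complete_square M G hM hMG J (v - G J)
  rw [add_sub_cancel] at h
  rw [h]

variable [MeasurableSpace A] [BorelSpace A]

/-- Gaussians with a source are integrable when the Gaussian is (translation invariance of `dA`).
[cite: Balaban1984PropagatorsII, (2.28) p.227] -/
theorem integrable_gauss_shift (μ : Measure A) [μ.IsAddLeftInvariant] (M G : A →ₗ[ℝ] A)
    (hM : ∀ x y : A, ⟪M x, y⟫_ℝ = ⟪x, M y⟫_ℝ) (hMG : M ∘ₗ G = LinearMap.id)
    (hint : Integrable (fun v => Real.exp (-(1 / 2) * ⟪v, M v⟫_ℝ)) μ) (J : A) :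
    Integrable (fun v => Real.exp (-(1 / 2) * ⟪v, M v⟫_ℝ + ⟪v, J⟫_ℝ)) μ := by
  have h : (fun v => Real.exp (-(1 / 2) * ⟪v, M v⟫_ℝ + ⟪v, J⟫_ℝ)) =
      fun v => Real.exp ((1 / 2) * ⟪J, G J⟫_ℝ) *
        (fun w => Real.exp (-(1 / 2) * ⟪w, M w⟫_ℝ)) (v - G J) := by
    funext v; exact gauss_shift_eq M G hM hMG J v
  rw [h]
  exact (hint.comp_sub_right (G J)).const_mul _

/-- `|x| ≤ e^x + e^{−x}`. [folklore] -/
private theorem abs_le_exp_add_exp_neg (x : ℝ) : |x| ≤ Real.exp x + Real.exp (-x) := by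
  rcases le_total 0 x with hx | hx
  · rw [abs_of_nonneg hx]
    linarith [Real.add_one_le_exp x, Real.exp_pos (-x)]
  · rw [abs_of_nonpos hx]
    linarith [Real.add_one_le_exp (-x), Real.exp_pos x]

/-- Gaussian-with-source times a linear form `⟨A,J₁⟩` is integrable (`|x| ≤ e^x + e^{−x}`: dominated by two shifted
Gaussians) — the integrability behind the moment (2.32). [cite: Balaban1984PropagatorsII, (2.32) p.227] -/
theorem integrable_gauss_linear (μ : Measure A) [μ.IsAddLeftInvariant] (M G : A →ₗ[ℝ] A)
    (hM : ∀ x y : A, ⟪M x, y⟫_ℝ = ⟪x, M y⟫_ℝ) (hMG : M ∘ₗ G = LinearMap.id)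
    (hint : Integrable (fun v => Real.exp (-(1 / 2) * ⟪v, M v⟫_ℝ)) μ) (J J₁ : A) :
    Integrable (fun v => Real.exp (-(1 / 2) * ⟪v, M v⟫_ℝ + ⟪v, J⟫_ℝ) * ⟪v, J₁⟫_ℝ) μ := by
  have h1 := integrable_gauss_shift μ M G hM hMG hint (J + J₁)
  have h2 := integrable_gauss_shift μ M G hM hMG hint (J - J₁)
  refine Integrable.mono' (h1.add h2) ?_ ?_
  · exact ((integrable_gauss_shift μ M G hM hMG hint J).aestronglyMeasurable).mul
      (continuous_id.inner continuous_const).aestronglyMeasurable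
  · refine ae_of_all _ fun v => ?_
    rw [norm_mul, Real.norm_eq_abs, Real.norm_eq_abs, abs_of_pos (Real.exp_pos _)]
    simp only [Pi.add_apply, inner_add_right, inner_sub_right]
    calc Real.exp (-(1 / 2) * ⟪v, M v⟫_ℝ + ⟪v, J⟫_ℝ) * |⟪v, J₁⟫_ℝ|
        ≤ Real.exp (-(1 / 2) * ⟪v, M v⟫_ℝ + ⟪v, J⟫_ℝ) * (Real.exp ⟪v, J₁⟫_ℝ + Real.exp (-⟪v, J₁⟫_ℝ)) :=
          mul_le_mul_of_nonneg_left (abs_le_exp_add_exp_neg _) (Real.exp_pos _).le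
      _ = Real.exp (-(1 / 2) * ⟪v, M v⟫_ℝ + (⟪v, J⟫_ℝ + ⟪v, J₁⟫_ℝ)) +
          Real.exp (-(1 / 2) * ⟪v, M v⟫_ℝ + (⟪v, J⟫_ℝ - ⟪v, J₁⟫_ℝ)) := by
          rw [mul_add, ← Real.exp_add, ← Real.exp_add]; ring_nf

/-- **Gaussian first moment with a source** (translation `A → A + GJ` + oddness of `⟨A,J₁⟩e^{−½⟨A,MA⟩}`): for `dA`
translation- and reflection-invariant, `M` symmetric with `MG = I` and an integrable Gaussian,
`∫ e^{−½⟨A,MA⟩ + ⟨A,J⟩} ⟨A,J₁⟩ dA = ⟨GJ, J₁⟩ e^{½⟨J,GJ⟩} Z`, `Z = ∫ e^{−½⟨A,MA⟩}dA`.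
[cite: Balaban1984PropagatorsII, (2.32) p.227] -/
theorem integral_gauss_linear (μ : Measure A) [μ.IsAddLeftInvariant] [μ.IsNegInvariant]
    (M G : A →ₗ[ℝ] A) (hM : ∀ x y : A, ⟪M x, y⟫_ℝ = ⟪x, M y⟫_ℝ) (hMG : M ∘ₗ G = LinearMap.id)
    (hint : Integrable (fun v => Real.exp (-(1 / 2) * ⟪v, M v⟫_ℝ)) μ) (J J₁ : A) :
    ∫ v, Real.exp (-(1 / 2) * ⟪v, M v⟫_ℝ + ⟪v, J⟫_ℝ) * ⟪v, J₁⟫_ℝ ∂μ =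
      ⟪G J, J₁⟫_ℝ * Real.exp ((1 / 2) * ⟪J, G J⟫_ℝ) * ∫ v, Real.exp (-(1 / 2) * ⟪v, M v⟫_ℝ) ∂μ := by
  -- translate v → GJ + v
  have hkey : ∀ v, Real.exp (-(1 / 2) * ⟪G J + v, M (G J + v)⟫_ℝ + ⟪G J + v, J⟫_ℝ) * ⟪G J + v, J₁⟫_ℝ =
      Real.exp ((1 / 2) * ⟪J, G J⟫_ℝ) * (Real.exp (-(1 / 2) * ⟪v, M v⟫_ℝ) * ⟪v, J₁⟫_ℝ) +
        (⟪G J, J₁⟫_ℝ * Real.exp ((1 / 2) * ⟪J, G J⟫_ℝ)) * Real.exp (-(1 / 2) * ⟪v, M v⟫_ℝ) := by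
    intro v
    rw [gauss_complete_square M G hM hMG J v, Real.exp_add, inner_add_left]
    ring
  have hodd : ∫ v, Real.exp (-(1 / 2) * ⟪v, M v⟫_ℝ) * ⟪v, J₁⟫_ℝ ∂μ = 0 := by
    have h := integral_neg_eq_self (fun v => Real.exp (-(1 / 2) * ⟪v, M v⟫_ℝ) * ⟪v, J₁⟫_ℝ) μ
    simp only [map_neg, inner_neg_left, inner_neg_right, neg_neg, mul_neg] at h
    rw [integral_neg] at h
    linarith
  have hI1 : Integrable (fun v => Real.exp (-(1 / 2) * ⟪v, M v⟫_ℝ) * ⟪v, J₁⟫_ℝ) μ := by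
    have := integrable_gauss_linear μ M G hM hMG hint 0 J₁
    simpa using this
  calc ∫ v, Real.exp (-(1 / 2) * ⟪v, M v⟫_ℝ + ⟪v, J⟫_ℝ) * ⟪v, J₁⟫_ℝ ∂μ
      = ∫ v, Real.exp (-(1 / 2) * ⟪G J + v, M (G J + v)⟫_ℝ + ⟪G J + v, J⟫_ℝ) * ⟪G J + v, J₁⟫_ℝ ∂μ :=
        (integral_add_left_eq_self (fun v => Real.exp (-(1 / 2) * ⟪v, M v⟫_ℝ + ⟪v, J⟫_ℝ) * ⟪v, J₁⟫_ℝ)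
          (G J)).symm
    _ = Real.exp ((1 / 2) * ⟪J, G J⟫_ℝ) * ∫ v, Real.exp (-(1 / 2) * ⟪v, M v⟫_ℝ) * ⟪v, J₁⟫_ℝ ∂μ +
        (⟪G J, J₁⟫_ℝ * Real.exp ((1 / 2) * ⟪J, G J⟫_ℝ)) * ∫ v, Real.exp (-(1 / 2) * ⟪v, M v⟫_ℝ) ∂μ := by
        simp_rw [hkey]
        rw [integral_add (hI1.const_mul _) (hint.const_mul _), integral_const_mul, integral_const_mul]
    _ = ⟪G J, J₁⟫_ℝ * Real.exp ((1 / 2) * ⟪J, G J⟫_ℝ) * ∫ v, Real.exp (-(1 / 2) * ⟪v, M v⟫_ℝ) ∂μ := by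
        rw [hodd, mul_zero, zero_add]

/-- `e^{|x|} ≤ e^x + e^{−x}`. [folklore] -/
private theorem exp_abs_le (x : ℝ) : Real.exp |x| ≤ Real.exp x + Real.exp (-x) := by
  rcases le_total 0 x with hx | hx
  · rw [abs_of_nonneg hx]; linarith [Real.exp_pos (-x)]
  · rw [abs_of_nonpos hx]; linarith [Real.exp_pos x]

/-- `|x| ≤ e^{|x|}`. [folklore] -/
private theorem abs_le_exp_abs (x : ℝ) : |x| ≤ Real.exp |x| := by
  linarith [Real.add_one_le_exp |x|]

/-- **Gaussian second moment (the covariance `G = Δ_a⁻¹` as a Gaussian integral — the content of (2.32)):** for `dA`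
translation- and reflection-invariant, `M` symmetric with `MG = I` and an integrable Gaussian,
`∫ e^{−½⟨A,MA⟩} ⟨A,J₁⟩⟨A,J₂⟩ dA = ⟨GJ₂, J₁⟩ Z` — the `t`-derivative at `0` of the first moment with source `tJ₂`
(`= t⟨GJ₂,J₁⟩e^{½t²⟨J₂,GJ₂⟩}Z`), differentiated under the integral sign with the dominating function
`e^{−½⟨A,MA⟩}(e^{2⟨A,J₂⟩}+e^{−2⟨A,J₂⟩})(e^{⟨A,J₁⟩}+e^{−⟨A,J₁⟩})` on `|t| < 1`. [cite: Balaban1984PropagatorsII, (2.32) p.227] -/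
theorem integral_gauss_bilinear (μ : Measure A) [μ.IsAddLeftInvariant] [μ.IsNegInvariant]
    (M G : A →ₗ[ℝ] A) (hM : ∀ x y : A, ⟪M x, y⟫_ℝ = ⟪x, M y⟫_ℝ) (hMG : M ∘ₗ G = LinearMap.id)
    (hint : Integrable (fun v => Real.exp (-(1 / 2) * ⟪v, M v⟫_ℝ)) μ) (J₁ J₂ : A) :
    ∫ v, Real.exp (-(1 / 2) * ⟪v, M v⟫_ℝ) * (⟪v, J₁⟫_ℝ * ⟪v, J₂⟫_ℝ) ∂μ =
      ⟪G J₂, J₁⟫_ℝ * ∫ v, Real.exp (-(1 / 2) * ⟪v, M v⟫_ℝ) ∂μ := by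
  set Z := ∫ v, Real.exp (-(1 / 2) * ⟪v, M v⟫_ℝ) ∂μ with hZ
  -- the parametrised integrand and its `t`-derivative
  set F : ℝ → A → ℝ := fun t v => Real.exp (-(1 / 2) * ⟪v, M v⟫_ℝ + ⟪v, t • J₂⟫_ℝ) * ⟪v, J₁⟫_ℝ with hF
  set F' : ℝ → A → ℝ := fun t v =>
    Real.exp (-(1 / 2) * ⟪v, M v⟫_ℝ + ⟪v, t • J₂⟫_ℝ) * ⟪v, J₁⟫_ℝ * ⟪v, J₂⟫_ℝ with hF'
  -- closed form of `∫ F t` (first moment with source `tJ₂`)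
  have hclosed : ∀ t, ∫ v, F t v ∂μ =
      t * ⟪G J₂, J₁⟫_ℝ * Real.exp ((1 / 2) * (t ^ 2 * ⟪J₂, G J₂⟫_ℝ)) * Z := by
    intro t
    simp only [hF]
    rw [integral_gauss_linear μ M G hM hMG hint (t • J₂) J₁]
    have h : ⟪G (t • J₂), J₁⟫_ℝ * Real.exp ((1 / 2) * ⟪t • J₂, G (t • J₂)⟫_ℝ) =
        t * ⟪G J₂, J₁⟫_ℝ * Real.exp ((1 / 2) * (t ^ 2 * ⟪J₂, G J₂⟫_ℝ)) := by
      rw [map_smul, real_inner_smul_left, real_inner_smul_left, real_inner_smul_right]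
      ring_nf
    rw [h]
  have hφ : HasDerivAt (fun t : ℝ => t * ⟪G J₂, J₁⟫_ℝ * Real.exp ((1 / 2) * (t ^ 2 * ⟪J₂, G J₂⟫_ℝ)) * Z)
      (⟪G J₂, J₁⟫_ℝ * Z) 0 := by
    have h1 : HasDerivAt (fun t : ℝ => t * ⟪G J₂, J₁⟫_ℝ) ⟪G J₂, J₁⟫_ℝ 0 := by
      simpa using (hasDerivAt_id (0 : ℝ)).mul_const ⟪G J₂, J₁⟫_ℝ
    have h2 : HasDerivAt (fun t : ℝ => Real.exp ((1 / 2) * (t ^ 2 * ⟪J₂, G J₂⟫_ℝ)))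
        (Real.exp ((1 / 2) * ((0 : ℝ) ^ 2 * ⟪J₂, G J₂⟫_ℝ)) * ((1 / 2) * (2 * (0 : ℝ) ^ 1 * 1 * ⟪J₂, G J₂⟫_ℝ))) 0 :=
      ((((hasDerivAt_id (0 : ℝ)).pow 2).mul_const _).const_mul _).exp
    have h3 := (h1.mul h2).mul_const Z
    simpa using h3
  -- domination on `|t| < 1`
  set bound : A → ℝ := fun v =>
    Real.exp (-(1 / 2) * ⟪v, M v⟫_ℝ + ⟪v, (2 : ℝ) • J₂ + J₁⟫_ℝ) +
    Real.exp (-(1 / 2) * ⟪v, M v⟫_ℝ + ⟪v, (2 : ℝ) • J₂ - J₁⟫_ℝ) +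
    Real.exp (-(1 / 2) * ⟪v, M v⟫_ℝ + ⟪v, -((2 : ℝ) • J₂) + J₁⟫_ℝ) +
    Real.exp (-(1 / 2) * ⟪v, M v⟫_ℝ + ⟪v, -((2 : ℝ) • J₂) - J₁⟫_ℝ) with hbound
  have hbound_int : Integrable bound μ :=
    (((integrable_gauss_shift μ M G hM hMG hint _).add (integrable_gauss_shift μ M G hM hMG hint _)).add
      (integrable_gauss_shift μ M G hM hMG hint _)).add (integrable_gauss_shift μ M G hM hMG hint _)
  have hbound_eq : ∀ v, bound v = Real.exp (-(1 / 2) * ⟪v, M v⟫_ℝ) *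
      ((Real.exp (2 * ⟪v, J₂⟫_ℝ) + Real.exp (-(2 * ⟪v, J₂⟫_ℝ))) *
        (Real.exp ⟪v, J₁⟫_ℝ + Real.exp (-⟪v, J₁⟫_ℝ))) := by
    intro v
    simp only [hbound, inner_add_right, inner_sub_right, inner_neg_right, real_inner_smul_right, Real.exp_add,
      Real.exp_sub, Real.exp_neg]
    have h1 := Real.exp_pos (2 * ⟪v, J₂⟫_ℝ)
    have h2 := Real.exp_pos ⟪v, J₁⟫_ℝ
    field_simp
    ring
  have h_bound : ∀ᵐ v ∂μ, ∀ t ∈ Metric.ball (0 : ℝ) 1, ‖F' t v‖ ≤ bound v := by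
    refine ae_of_all _ fun v t ht => ?_
    have ht' : |t| ≤ 1 := by
      have := mem_ball_zero_iff.mp ht
      exact (le_of_lt this)
    simp only [hF', real_inner_smul_right]
    rw [hbound_eq, Real.norm_eq_abs, abs_mul, abs_mul, abs_of_pos (Real.exp_pos _), Real.exp_add, mul_assoc,
      mul_assoc]
    refine mul_le_mul_of_nonneg_left ?_ (Real.exp_pos _).le
    -- `e^{tx}|y||x| ≤ e^{|x|}·e^{|y|}·e^{|x|} ≤ (e^{2x}+e^{-2x})(e^{y}+e^{-y})`
    have hx1 : Real.exp (t * ⟪v, J₂⟫_ℝ) ≤ Real.exp |⟪v, J₂⟫_ℝ| := by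
      apply Real.exp_le_exp.mpr
      calc t * ⟪v, J₂⟫_ℝ ≤ |t * ⟪v, J₂⟫_ℝ| := le_abs_self _
        _ = |t| * |⟪v, J₂⟫_ℝ| := abs_mul _ _
        _ ≤ 1 * |⟪v, J₂⟫_ℝ| := mul_le_mul_of_nonneg_right ht' (abs_nonneg _)
        _ = |⟪v, J₂⟫_ℝ| := one_mul _
    have hx2 : |⟪v, J₂⟫_ℝ| ≤ Real.exp |⟪v, J₂⟫_ℝ| := abs_le_exp_abs _
    have hy : |⟪v, J₁⟫_ℝ| ≤ Real.exp |⟪v, J₁⟫_ℝ| := abs_le_exp_abs _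
    have hxx : Real.exp |⟪v, J₂⟫_ℝ| * Real.exp |⟪v, J₂⟫_ℝ| ≤
        Real.exp (2 * ⟪v, J₂⟫_ℝ) + Real.exp (-(2 * ⟪v, J₂⟫_ℝ)) := by
      rw [← Real.exp_add, ← two_mul]
      have := exp_abs_le (2 * ⟪v, J₂⟫_ℝ)
      rwa [abs_mul, abs_two] at this
    have hyy : Real.exp |⟪v, J₁⟫_ℝ| ≤ Real.exp ⟪v, J₁⟫_ℝ + Real.exp (-⟪v, J₁⟫_ℝ) := exp_abs_le _
    calc Real.exp (t * ⟪v, J₂⟫_ℝ) * (|⟪v, J₁⟫_ℝ| * |⟪v, J₂⟫_ℝ|)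
        ≤ Real.exp |⟪v, J₂⟫_ℝ| * (Real.exp |⟪v, J₁⟫_ℝ| * Real.exp |⟪v, J₂⟫_ℝ|) := by
          gcongr
      _ = (Real.exp |⟪v, J₂⟫_ℝ| * Real.exp |⟪v, J₂⟫_ℝ|) * Real.exp |⟪v, J₁⟫_ℝ| := by ring
      _ ≤ (Real.exp (2 * ⟪v, J₂⟫_ℝ) + Real.exp (-(2 * ⟪v, J₂⟫_ℝ))) *
          (Real.exp ⟪v, J₁⟫_ℝ + Real.exp (-⟪v, J₁⟫_ℝ)) := by
          gcongr
  -- differentiability in `t`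
  have h_diff : ∀ᵐ v ∂μ, ∀ t ∈ Metric.ball (0 : ℝ) 1, HasDerivAt (fun t => F t v) (F' t v) t := by
    refine ae_of_all _ fun v t _ => ?_
    simp only [hF, hF', real_inner_smul_right]
    have h : HasDerivAt (fun s : ℝ => Real.exp (-(1 / 2) * ⟪v, M v⟫_ℝ + s * ⟪v, J₂⟫_ℝ) * ⟪v, J₁⟫_ℝ)
        (Real.exp (-(1 / 2) * ⟪v, M v⟫_ℝ + t * ⟪v, J₂⟫_ℝ) * (1 * ⟪v, J₂⟫_ℝ) * ⟪v, J₁⟫_ℝ) t :=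
      (((hasDerivAt_id t).mul_const ⟪v, J₂⟫_ℝ).const_add (-(1 / 2) * ⟪v, M v⟫_ℝ)).exp.mul_const ⟪v, J₁⟫_ℝ
    exact h.congr_deriv (by ring)
  have hF_meas : ∀ᶠ t in nhds (0 : ℝ), AEStronglyMeasurable (F t) μ :=
    Filter.Eventually.of_forall fun t => (integrable_gauss_linear μ M G hM hMG hint (t • J₂) J₁).aestronglyMeasurable
  have hF_int : Integrable (F 0) μ := integrable_gauss_linear μ M G hM hMG hint ((0 : ℝ) • J₂) J₁
  have hF'_meas : AEStronglyMeasurable (F' 0) μ :=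
    (integrable_gauss_linear μ M G hM hMG hint ((0 : ℝ) • J₂) J₁).aestronglyMeasurable.mul
      (continuous_id.inner continuous_const).aestronglyMeasurable
  have hmain := (hasDerivAt_integral_of_dominated_loc_of_deriv_le (Metric.ball_mem_nhds (0 : ℝ) one_pos)
    hF_meas hF_int hF'_meas h_bound hbound_int h_diff).2
  have hfun : (fun t => ∫ v, F t v ∂μ) =
      fun t => t * ⟪G J₂, J₁⟫_ℝ * Real.exp ((1 / 2) * (t ^ 2 * ⟪J₂, G J₂⟫_ℝ)) * Z := funext hclosed
  rw [hfun] at hmain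
  have huniq := hmain.unique hφ
  -- `∫ F' 0 = ∫ e^{−½⟨v,Mv⟩}⟨v,J₁⟩⟨v,J₂⟩`
  have h0 : ∫ v, F' 0 v ∂μ = ∫ v, Real.exp (-(1 / 2) * ⟪v, M v⟫_ℝ) * (⟪v, J₁⟫_ℝ * ⟪v, J₂⟫_ℝ) ∂μ := by
    simp only [hF', zero_smul, inner_zero_right, add_zero, mul_assoc]
  rw [← h0, huniq]

end GaussianMoments

/-! ## §2  (2.32) -/

section Display232

variable {V A W : Type*} [NormedAddCommGroup V] [InnerProductSpace ℝ V]
  [NormedAddCommGroup A] [InnerProductSpace ℝ A] [MeasurableSpace A] [BorelSpace A]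
  [NormedAddCommGroup W] [InnerProductSpace ℝ W]

/-- **(2.32): `R∂*GQ* = Z⁻¹∫dA e^{−½⟨A,Δ_aA⟩} R∂*A QA`** — the Gaussian second moment with covariance `G = Δ_a⁻¹`,
typed through its matrix elements: `Z·⟨g, R∂*GQ*u⟩ = ∫dA e^{−½⟨A,Δ_aA⟩}⟨g,R∂*A⟩⟨QA,u⟩` for all `g`, `u` (`⟨g,R∂*A⟩ =
⟨∂Rg, A⟩`, `⟨QA,u⟩ = ⟨A,Q*u⟩`; `R` the orthogonal projection onto `K = ΔN(Q′)`, `∂*`/`∂` and `Q*`/`Q` adjoint pairs,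
`Δ_a = M` symmetric, `MG = I`; `dA` translation- and reflection-invariant, the Gaussian integrable, e.g. `Z ≠ 0`).
[cite: Balaban1984PropagatorsII, (2.32) p.227] -/
theorem eq232 (μ : Measure A) [μ.IsAddLeftInvariant] [μ.IsNegInvariant] (M G : A →ₗ[ℝ] A) (d : V →ₗ[ℝ] A)
    (dstar : A →ₗ[ℝ] V) (Rp : V →ₗ[ℝ] V) (Q : A →ₗ[ℝ] W) (Qs : W →ₗ[ℝ] A) (K : Submodule ℝ V)
    [K.HasOrthogonalProjection] (hR : ∀ g, Rp g = K.starProjection g)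
    (hadj : ∀ (v : A) (g : V), ⟪v, d g⟫_ℝ = ⟪dstar v, g⟫_ℝ) (hQadj : ∀ (w : W) (v : A), ⟪Qs w, v⟫_ℝ = ⟪w, Q v⟫_ℝ)
    (hM : ∀ x y : A, ⟪M x, y⟫_ℝ = ⟪x, M y⟫_ℝ) (hMG : M ∘ₗ G = LinearMap.id)
    (hint : Integrable (fun v => Real.exp (-(1 / 2) * ⟪v, M v⟫_ℝ)) μ) (g : V) (u : W) :
    (∫ v, Real.exp (-(1 / 2) * ⟪v, M v⟫_ℝ) ∂μ) * ⟪g, (Rp ∘ₗ dstar ∘ₗ G ∘ₗ Qs) u⟫_ℝ =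
      ∫ v, Real.exp (-(1 / 2) * ⟪v, M v⟫_ℝ) * (⟪g, Rp (dstar v)⟫_ℝ * ⟪Q v, u⟫_ℝ) ∂μ := by
  have hRsymm : ∀ x y : V, ⟪Rp x, y⟫_ℝ = ⟪x, Rp y⟫_ℝ := fun x y => by
    rw [hR, hR]; exact Submodule.inner_starProjection_left_eq_right K x y
  have h1 : ∀ v, ⟪g, Rp (dstar v)⟫_ℝ = ⟪v, d (Rp g)⟫_ℝ := fun v => by
    rw [← hRsymm, hadj, real_inner_comm]
  have h2 : ∀ v, ⟪Q v, u⟫_ℝ = ⟪v, Qs u⟫_ℝ := fun v => by rw [real_inner_comm, ← hQadj, real_inner_comm]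
  simp_rw [h1, h2]
  rw [integral_gauss_bilinear μ M G hM hMG hint (d (Rp g)) (Qs u), mul_comm]
  congr 1
  simp only [LinearMap.coe_comp, Function.comp_apply]
  rw [← hRsymm, hadj, real_inner_comm]

end Display232

end Literature.MathematicalPhysics.QuantumFieldTheory.Balaban1983to89.B6Eq232GaussianMoment

end
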